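import Summits.BirchSwinnertonDyer.BirchSwinnertonDyer.Theses.GenusKolyvaginAtTwo
import Summits.BirchSwinnertonDyer.BirchSwinnertonDyer.Theses.TwoAdicConverse
import Literature.NumberTheory.EllipticCurves.BSDSelmer
import Literature.NumberTheory.EllipticCurves.QuadraticTwistHeegnerRootNumberProofs
import Literature.NumberTheory.EllipticCurves.RootNumberSmulProofs
import Literature.NumberTheory.EllipticCurves.RootNumberEvenAnalyticRankProofs
import Literature.NumberTheory.EllipticCurves.IrreducibleModPQuadraticTwistProofs
import Literature.NumberTheory.EllipticCurves.SelmerTrivialCorankProofs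
import Literature.NumberTheory.EllipticCurves.NonEisensteinPrimeOfSurjective
import Literature.NumberTheory.EllipticCurves.BSDRankZeroDensityProofs
import Literature.NumberTheory.EllipticCurves.SelmerCorankHolds
import Literature.NumberTheory.EllipticCurves.SelmerCorankProofs
import Literature.Algebra.Module.AlternatingPairingParity
import Literature.NumberTheory.EllipticCurves.ComplexMultiplicationHasCMProofs

/-!
# Route `GenusKolyvaginAtTwo`, crux `GenusPrimitiveSupplyAtTwo` (stmt-BirchSwinnertonDyer-22136), line `genus-supply`:
# stub A (minimal-twin supply) REDUCES TO THE RANK-ONE `2`-CONVERSE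

Lead prover seat bsd-line-gk2-p1 (g2, 2026-08-28), cell `bsd-f1-sign2`. Helper for the registered stub
`stub_minimalTwinSupplyAtTwo` of line `genus-supply` (skeleton `Cruxes/GenusPrimitiveSupplyAtTwo/Lines/genus_supply.lean`):
for `E` in the A-class (non-CM, `r_an(E) = 0`, `ρ_{E,2^n}` onto for all `n ≥ 1`) there is a Kolyvagin-(H2)-admissible
Heegner field `K` and a globally minimal model `Wd ≅ E^{(d_K)}` with `r_an(Wd) = 1` AND `#Sel₂(Wd) = 2`.

HONEST FRAMING. Stub A stays OPEN; BSD is not proved by any of this. What is proved is bookkeeping from PUBLISHED inputs,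
isolating the two statements that are NOT bookkeeping:

* (SUPPLY) «some admissible Heegner twist is `2`-Selmer-minimal»: `∃ K` admissible, `∃ Wd ≅ E^{(d_K)}` globally minimal
  with `#Sel₂(Wd) = 2` — stub A WITHOUT its analytic clause `r_an(Wd) = 1`. A Mazur–Rubin ∕ Klagsbrun–Mazur–Rubin-type
  `2`-Selmer-rank-one twist existence INSIDE the local class «`d_K < 0`, odd, every `q ∣ N_E` split» (Mazur–Rubin 2010
  Thm. 1.4 ∕ Prop. 3.3; Klagsbrun–Mazur–Rubin 2013–14 Markov model for `Gal(ℚ(E[2])/ℚ) ≅ S₃`); data-true on 591/591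
  WALL-row-1 habitat cells (census W52 ADDENDUM-1 on the item). Whether the printed theorems cover this local class
  verbatim is for the literature seats; here it is a HYPOTHESIS spelled out in binders (`hsupply`).
* (CONV₂) «the rank-one `2`-converse for non-CM curves»: `corank_{ℤ₂} Sel_{2^∞}(V/ℚ) = 1 ⟹ ord_{s=1} L(V,s) = 1` — the
  tree's OPEN crux `Summit.BirchSwinnertonDyer.BirchSwinnertonDyer.Theses.TwoAdicConverse.RankOneTwoConverse`
  (stmt-BirchSwinnertonDyer-19220, there with the clause «good ordinary or multiplicative at 2»; Skinner 2020 ∕ W. Zhang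
  2014 ∕ Burungale–Skinner–Tian–Wan 2024 are all `p` odd). Hypothesis `hconv`.

THE REDUCTION (`stub_minimalTwinSupplyAtTwo_of_twoConverse`): Modularity (`exists_isNewformOf`, BCDT 2001) ∧ the `2`-parity
theorem (`p_parity · 2`, Dokchitser–Dokchitser 2010 Thm. 1.4 with Monsky) ∧ (CONV₂) ∧ (SUPPLY) ⟹ stub A VERBATIM. Chain:
`ρ̄_{E,2}` onto ⟹ `E[2]` irreducible, a twist- and model-invariant (`hasIrreducibleModPGaloisRep_iff_of_smul_eq_quadraticTwist`)
⟹ `Wd(ℚ)[2] = 0`; the descent count `#Sel₂ = 2^{rank}·#Wd(ℚ)[2]·#Ш[2]` (Silverman X.4.2, tree THEOREM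
`natCard_selmerGroup_eq`) at `#Sel₂ = 2` leaves (rank, #Ш[2]) ∈ {(1,1), (0,2)}; the corank identity
`corank Sel_{2^∞} = rank + corank Ш[2^∞]` (Greenberg, tree THEOREM `selmerCorank_eq_mordellWeilRank_add_holds`) and
`corank Ш[2^∞] ≤ dim Ш[2^∞][2] = dim Ш[2]` give `corank ≤ 1`; the Heegner twist has root number `w(Wd) = −w(E) = −1`
(Darmon Thm. 3.17, tree `rootNumber_quadraticTwist_discr_eq_neg_of_exists_isNewformOf`; `w(E) = (−1)^{r_an(E)} = 1`;
model invariance `rootNumber_smul_holds`), so `2`-parity makes the corank odd, hence `= 1`; (CONV₂) gives `r_an(Wd) = 1`.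
Conversely stub A ⟹ (SUPPLY) trivially (`minimalSelmerTwinSupply_of_stub`), so MODULO PUBLISHED FACTS AND (CONV₂), STUB A
IS (SUPPLY): the analytic clause of stub A costs exactly the rank-one `2`-converse on the twin class — stub A is not
cheaper than, and not independent of, crux 19220 of route `TwoAdicConverse`.
presearch (2026-08-28): lit search --hybrid «2-Selmer rank one quadratic twist prescribed local conditions Mazur Rubin»;
lit search --hybrid «p-converse theorem p = 2 non-CM elliptic curve Selmer corank one analytic rank one»; tree:
`BSDSelmer.lean` S25 block (all `p`-converses typed `p ≠ 2` / `5 ≤ p`), `Theses/TwoAdicConverse.lean` (19220 open, XL) ⇒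
(CONV₂) not in print; (SUPPLY) Mazur–Rubin-type, local-class coverage to be placed by -ref2.
No summit and no leaf is proved by this file; BSD is not proved by any of this.
-/

set_option linter.dupNamespace false -- tree convention: `Summit.BirchSwinnertonDyer.BirchSwinnertonDyer.Theorems` (summit = sub-problem)

noncomputable section


open scoped AddSubgroup

namespace Summit.BirchSwinnertonDyer.BirchSwinnertonDyer.Theorems.GenusKoly

open NumberField WeierstrassCurve Literature.NumberTheory.EllipticCurves
  Literature.NumberTheory.EllipticCurves.ModularForms

/-! ## §1 Bookkeeping lemmas -/

/-- **`corank_{ℤ₂} Ш(V/ℚ)[2^∞] ≤ k` when `#Ш(V/ℚ)[2] = 2^k`**: the corank formula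
`dim_{𝔽₂} Ш[2^∞][2] − dim_{𝔽₂} Ш[2^∞]/2` (tree `zpCorank`, Greenberg 1999 §1) is at most `dim_{𝔽₂} Ш[2^∞][2] = dim_{𝔽₂} Ш[2]`
(`Ш[2] ⊆ Ш[2^∞]`, tree `natCard_torsionBy_primaryComponent`). [cite: Greenberg1999, §1] -/
theorem shaCorank_two_le_of_natCard_sha_two (V : WeierstrassCurve ℚ) (k : ℕ)
    (h : Nat.card (V.sha ⊓ V.galH1[((2 : ℕ) : ℤ)] : AddSubgroup V.galH1) = 2 ^ k) :
    V.shaCorank 2 ≤ k := by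
  haveI : Fact (Nat.Prime 2) := ⟨Nat.prime_two⟩
  letI : Module (ZMod 2) (↥(AddCommGroup.primaryComponent V.sha 2))[((2 : ℕ) : ℤ)] :=
    AddSubgroup.torsionBy.zmodModule
  have hc : Nat.card (↥(AddCommGroup.primaryComponent V.sha 2))[((2 : ℕ) : ℤ)] = 2 ^ k := by
    rw [Literature.Algebra.Module.natCard_torsionBy_primaryComponent,
      Literature.Algebra.Module.natCard_torsionBy_addSubgroup]
    exact h
  haveI : Finite (↥(AddCommGroup.primaryComponent V.sha 2))[((2 : ℕ) : ℤ)] :=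
    Nat.finite_of_card_ne_zero (by rw [hc]; positivity)
  have e1 := pow_finrank_eq_natCard (p := 2) ((↥(AddCommGroup.primaryComponent V.sha 2))[((2 : ℕ) : ℤ)])
  have hfr : Module.finrank (ZMod 2) (↥(AddCommGroup.primaryComponent V.sha 2))[((2 : ℕ) : ℤ)] = k :=
    Nat.pow_right_injective le_rfl (e1.trans hc)
  unfold WeierstrassCurve.shaCorank zpCorank
  omega

/-- **`#Sel₂(V/ℚ) = 2`, `V(ℚ)[2] = 0` and an ODD `2^∞`-Selmer corank force `corank_{ℤ₂} Sel_{2^∞}(V/ℚ) = 1`.** The descent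
count `#Sel₂ = 2^{rank} · #V(ℚ)[2] · #Ш[2]` (Silverman AEC X.4.2, tree `natCard_selmerGroup_eq`) leaves
`(rank, #Ш[2]) ∈ {(1, 1), (0, 2)}`; with `corank Sel_{2^∞} = rank + corank Ш[2^∞]` (Greenberg 1999 §1, tree
`selmerCorank_eq_mordellWeilRank_add_holds`) and `corank Ш[2^∞] ≤ dim Ш[2]` the corank is `≤ 1`, and it is odd.
[cite: SilvermanAEC2009, Thm. X.4.2] [cite: Greenberg1999, §1] -/
theorem selmerCorank_two_eq_one_of_card_selmerGroup_two (V : WeierstrassCurve ℚ) [V.IsElliptic]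
    (htors : Nat.card V.toAffine.Point[((2 : ℕ) : ℤ)] = 1) (hSel : Nat.card (V.selmerGroup 2) = 2)
    (hodd : Odd (V.selmerCorank 2)) : V.selmerCorank 2 = 1 := by
  haveI : Fact (Nat.Prime 2) := ⟨Nat.prime_two⟩
  have hcard₀ := V.natCard_selmerGroup_eq (n := 2) two_ne_zero
  have hSel' : Nat.card (V.selmerGroup ((2 : ℕ) : ℤ)) = 2 := by
    rw [Nat.cast_ofNat]; exact hSel
  -- the descent count is stated with the classical `DecidableEq ℚ` on `E(ℚ)`; `convert` bridges the instance
  have hcard : Nat.card (V.selmerGroup ((2 : ℕ) : ℤ)) =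
      2 ^ V.mordellWeilRank * Nat.card V.toAffine.Point[((2 : ℕ) : ℤ)] *
        Nat.card (V.sha ⊓ V.galH1[((2 : ℕ) : ℤ)] : AddSubgroup V.galH1) := by
    convert hcard₀
  rw [hSel', htors, mul_one] at hcard
  -- `hcard : 2 = 2 ^ rank * #Ш[2]`
  have hce : V.selmerCorank 2 = V.mordellWeilRank + V.shaCorank 2 := V.selmerCorank_eq_mordellWeilRank_add_holds 2
  set r := V.mordellWeilRank with hr
  set c := Nat.card (V.sha ⊓ V.galH1[((2 : ℕ) : ℤ)] : AddSubgroup V.galH1) with hc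
  rcases Nat.lt_or_ge r 2 with hlt | hge
  · interval_cases r
    · -- rank `0`, `#Ш[2] = 2`
      have hc2 : c = 2 ^ 1 := by rw [pow_zero, one_mul] at hcard; rw [pow_one]; exact hcard.symm
      have hle := shaCorank_two_le_of_natCard_sha_two V 1 hc2
      obtain ⟨m, hm⟩ := hodd
      omega
    · -- rank `1`, `#Ш[2] = 1`
      have hc1 : c = 2 ^ 0 := by rw [pow_one] at hcard; rw [pow_zero]; omega
      have hle := shaCorank_two_le_of_natCard_sha_two V 0 hc1
      omega
  · exfalso
    have h4 : 4 ≤ 2 ^ r := by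
      calc (4 : ℕ) = 2 ^ 2 := by norm_num
        _ ≤ 2 ^ r := Nat.pow_le_pow_right two_pos hge
    rcases Nat.eq_zero_or_pos c with h0 | hpos
    · rw [h0, mul_zero] at hcard
      exact two_ne_zero hcard
    · have : 4 ≤ 2 ^ r * c := le_trans h4 (Nat.le_mul_of_pos_right _ hpos)
      omega

/-- **The twin has no rational `2`-torsion**: `ρ̄_{E,2}` onto ⟹ `E[2]` irreducible
(`hasIrreducibleModPGaloisRep_of_hasSurjectiveModNGaloisRep`), a twist- and model-invariant (Mazur 1978 ∕ tree
`hasIrreducibleModPGaloisRep_iff_of_smul_eq_quadraticTwist`), so `Wd(ℚ)[2] = 0` for every model `Wd ≅ E^{(d)}`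
(`natCard_torsionBy_eq_one_of_hasIrreducibleModPGaloisRep`). [cite: SilvermanAEC2009, X.5 Cor. 5.4] -/
theorem natCard_twoTorsion_twin_eq_one (W : WeierstrassCurve ℚ) [W.IsElliptic]
    (hsurj : W.HasSurjectiveModNGaloisRep ((2 : ℤ) ^ 1)) {d : ℚ} (hd : d ≠ 0)
    (Wd : WeierstrassCurve ℚ) [Wd.IsElliptic] (hWd : ∃ C : VariableChange ℚ, C • W.quadraticTwist d = Wd) :
    Nat.card Wd.toAffine.Point[((2 : ℕ) : ℤ)] = 1 := by
  haveI : Fact (Nat.Prime 2) := ⟨Nat.prime_two⟩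
  haveI : NeZero ((2 : ℕ) : ℚ) := ⟨by norm_num⟩
  haveI : NeZero (2 : ℚ) := ⟨two_ne_zero⟩
  have hirrW : W.HasIrreducibleModPGaloisRep 2 :=
    hasIrreducibleModPGaloisRep_of_hasSurjectiveModNGaloisRep W 2 (by simpa using hsurj)
  obtain ⟨C, hC⟩ := hWd
  have hC' : C⁻¹ • Wd = W.quadraticTwist d := by rw [← hC, inv_smul_smul]
  have hirr : Wd.HasIrreducibleModPGaloisRep 2 :=
    (hasIrreducibleModPGaloisRep_iff_of_smul_eq_quadraticTwist W Wd hd hC' 2).mpr hirrW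
  exact natCard_torsionBy_eq_one_of_hasIrreducibleModPGaloisRep Wd 2 hirr

/-- **The admissible twin has root number `−1`, from Modularity**: `w(Wd) = w(E^{(d_K)})` (model invariance, tree THEOREM
`rootNumber_smul_holds`) `= −w(E)` (every `q ∣ N_E` splits in `K`: Darmon 2004 Thm. 3.17, tree
`rootNumber_quadraticTwist_discr_eq_neg_of_exists_isNewformOf`) and `w(E) = (−1)^{r_an(E)} = 1` at `r_an(E) = 0`
(`rootNumber_eq_neg_one_pow_analyticRank_of_exists_isNewformOf`). [cite: Darmon2004, §3.6 Thm. 3.17 and p. 39]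
[cite: BCDTJAMS2001, Thm. A] -/
theorem rootNumber_twin_eq_neg_one (hmod : exists_isNewformOf) (W : WeierstrassCurve ℚ) [W.IsElliptic]
    (hr0 : W.analyticRank = 0) (K : Type) [Field K] [NumberField K] (hK : IsImaginaryQuadratic K)
    (hH : SatisfiesHeegnerHypothesis (W.conductorNorm ℤ) K) (Wd : WeierstrassCurve ℚ) [Wd.IsElliptic]
    (hWd : ∃ C : VariableChange ℚ, C • W.quadraticTwist (NumberField.discr K : ℚ) = Wd) :
    Wd.rootNumber = -1 := by
  have hd : (NumberField.discr K : ℚ) ≠ 0 := by exact_mod_cast NumberField.discr_ne_zero K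
  haveI := W.isElliptic_quadraticTwist hd
  obtain ⟨C, hC⟩ := hWd
  have h1 : Wd.rootNumber = (W.quadraticTwist (NumberField.discr K : ℚ)).rootNumber := by
    rw [← hC]
    exact (W.quadraticTwist (NumberField.discr K : ℚ)).rootNumber_smul_holds C
  rw [h1, rootNumber_quadraticTwist_discr_eq_neg_of_exists_isNewformOf W K hmod hK hH,
    rootNumber_eq_neg_one_pow_analyticRank_of_exists_isNewformOf hmod W, hr0, pow_zero]

/-- **`2`-parity at root number `−1` gives an odd `2^∞`-Selmer corank** (Dokchitser–Dokchitser 2010 Thm. 1.4: the named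
fact `p_parity V 2`, `(−1)^{corank} = w(V)`). [cite: DokchitserDokchitserAnnals2010, Thm. 1.4] -/
theorem odd_selmerCorank_two_of_p_parity (V : WeierstrassCurve ℚ) (hpar : p_parity V 2) (hw : V.rootNumber = -1) :
    Odd (V.selmerCorank 2) := by
  by_contra hodd
  rw [Nat.not_odd_iff_even] at hodd
  have h := hpar
  unfold p_parity at h
  rw [hodd.neg_one_pow, hw] at h
  norm_num at h

/-- **The twin is non-CM**: a model `Wd ≅ E^{(d)}` of a twist of a non-CM curve is non-CM (`j(Wd) = j(E^{(d)}) = j(E)`,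
Silverman AEC X.5.4, III.1.4(b); `HasCM` depends only on `j`, tree `hasCM_iff_of_j_eq`).
[cite: SilvermanAEC2009, X.5 Cor. 5.4 with III.1.4(b)] -/
theorem twin_not_hasCM (W : WeierstrassCurve ℚ) [W.IsElliptic] (hcm : ¬ W.HasCM) {d : ℚ} (hd : d ≠ 0)
    (Wd : WeierstrassCurve ℚ) [Wd.IsElliptic] (hWd : ∃ C : VariableChange ℚ, C • W.quadraticTwist d = Wd) :
    ¬ Wd.HasCM := by
  haveI := W.isElliptic_quadraticTwist hd
  obtain ⟨C, rfl⟩ := hWd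
  have hj : (C • W.quadraticTwist d).j = W.j := by
    rw [WeierstrassCurve.variableChange_j, W.j_quadraticTwist hd]
  exact fun h ↦ hcm ((hasCM_iff_of_j_eq hj).mp h)

/-! ## §2 Stub A from (SUPPLY) and the rank-one `2`-converse, modulo Modularity and `2`-parity -/

/-- **STUB A ⟸ (SUPPLY) ∧ (CONV₂), modulo Modularity and the `2`-parity theorem.** For `E` in the A-class (globally
minimal `W`, non-CM, `r_an(E) = 0`, `ρ_{E,2^n}` onto for all `n ≥ 1`): if (SUPPLY) some Kolyvagin-(H2)-admissible Heegner
field `K` (odd `d_K ≠ −3`, every `q ∣ N_E` split, `d_K·(−|Δ|)` and `d_K·(−2|Δ|)` non-squares) has a globally minimal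
`Wd ≅ E^{(d_K)}` with `#Sel₂(Wd) = 2`, and (CONV₂) every non-CM globally minimal `V/ℚ` with `corank_{ℤ₂} Sel_{2^∞}(V/ℚ) = 1`
has `ord_{s=1} L(V,s) = 1`, then the registered stub `stub_minimalTwinSupplyAtTwo` of line `genus-supply` holds VERBATIM:
that very `Wd` has `r_an(Wd) = 1`. Published inputs: `exists_isNewformOf` (BCDT 2001), `p_parity · 2`
(Dokchitser–Dokchitser 2010); everything else is a theorem of the tree (§1). (CONV₂) is OPEN (crux 19220 of route
`TwoAdicConverse`, here without its reduction-type clause); (SUPPLY) is Mazur–Rubin-type. Stub A is therefore (SUPPLY)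
modulo the `2`-converse — not an independent open problem. BSD is not proved by any of this.
[cite: DokchitserDokchitserAnnals2010, Thm. 1.4] [cite: Darmon2004, §3.6 Thm. 3.17] [cite: SilvermanAEC2009, Thm. X.4.2]
[cite: Greenberg1999, §1] [cite: MazurRubin2010, Thm. 1.4 and Prop. 3.3] -/
theorem stub_minimalTwinSupplyAtTwo_of_twoConverse (hmod : exists_isNewformOf)
    (hpar : ∀ V : WeierstrassCurve ℚ, p_parity V 2)
    (hconv : ∀ (V : WeierstrassCurve ℚ) [V.IsElliptic] [V.IsGloballyMinimal],
      ¬ V.HasCM → V.selmerCorank 2 = 1 → V.analyticRank = 1)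
    (hsupply : ∀ (W : WeierstrassCurve ℚ) [W.IsElliptic] [W.IsGloballyMinimal] [NeZero (W.conductorNorm ℤ)],
      ¬ W.HasCM → W.analyticRank = 0 → (∀ n : ℕ, 0 < n → W.HasSurjectiveModNGaloisRep ((2 : ℤ) ^ n)) →
      ∃ (K : Type) (_ : Field K) (_ : NumberField K),
        IsImaginaryQuadratic K ∧ Odd (NumberField.discr K) ∧ NumberField.discr K ≠ -3 ∧
        SatisfiesHeegnerHypothesis (W.conductorNorm ℤ) K ∧
        ¬ IsSquare ((NumberField.discr K : ℚ) * -|W.Δ|) ∧ ¬ IsSquare ((NumberField.discr K : ℚ) * (-(2 * |W.Δ|))) ∧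
        ∃ (Wd : WeierstrassCurve ℚ) (_ : Wd.IsElliptic) (_ : Wd.IsGloballyMinimal),
          (∃ C : WeierstrassCurve.VariableChange ℚ, C • W.quadraticTwist (NumberField.discr K : ℚ) = Wd) ∧
          Nat.card (Wd.selmerGroup 2) = 2) :
    ∀ (W : WeierstrassCurve ℚ) [W.IsElliptic] [W.IsGloballyMinimal] [NeZero (W.conductorNorm ℤ)],
      ¬ W.HasCM → W.analyticRank = 0 → (∀ n : ℕ, 0 < n → W.HasSurjectiveModNGaloisRep ((2 : ℤ) ^ n)) →
      ∃ (K : Type) (_ : Field K) (_ : NumberField K),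
        IsImaginaryQuadratic K ∧ Odd (NumberField.discr K) ∧ NumberField.discr K ≠ -3 ∧
        SatisfiesHeegnerHypothesis (W.conductorNorm ℤ) K ∧
        ¬ IsSquare ((NumberField.discr K : ℚ) * -|W.Δ|) ∧ ¬ IsSquare ((NumberField.discr K : ℚ) * (-(2 * |W.Δ|))) ∧
        ∃ (Wd : WeierstrassCurve ℚ) (_ : Wd.IsElliptic) (_ : Wd.IsGloballyMinimal),
          (∃ C : WeierstrassCurve.VariableChange ℚ, C • W.quadraticTwist (NumberField.discr K : ℚ) = Wd) ∧
          Wd.analyticRank = 1 ∧ Nat.card (Wd.selmerGroup 2) = 2 := by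
  intro W _ _ _ hcm hr0 hρ
  obtain ⟨K, iF, iN, hIQ, hodd, h3, hHe, hsq1, hsq2, Wd, iE, iM, hWd, hSel⟩ := hsupply W hcm hr0 hρ
  refine ⟨K, iF, iN, hIQ, hodd, h3, hHe, hsq1, hsq2, Wd, iE, iM, hWd, ?_, hSel⟩
  have hd : (NumberField.discr K : ℚ) ≠ 0 := by exact_mod_cast NumberField.discr_ne_zero K
  have hcmd : ¬ Wd.HasCM := twin_not_hasCM W hcm hd Wd hWd
  have htors := natCard_twoTorsion_twin_eq_one W (hρ 1 one_pos) hd Wd hWd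
  have hw := rootNumber_twin_eq_neg_one hmod W hr0 K hIQ hHe Wd hWd
  have hco := selmerCorank_two_eq_one_of_card_selmerGroup_two Wd htors hSel
    (odd_selmerCorank_two_of_p_parity Wd (hpar Wd) hw)
  exact hconv Wd hcmd hco

/-- **… and conversely, stub A ⟹ (SUPPLY)** (drop the analytic clause): so modulo Modularity, `2`-parity and (CONV₂) the
registered stub A IS (SUPPLY) — the reduction loses nothing. [folklore] -/
theorem minimalSelmerTwinSupply_of_stub
    (hA : ∀ (W : WeierstrassCurve ℚ) [W.IsElliptic] [W.IsGloballyMinimal] [NeZero (W.conductorNorm ℤ)],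
      ¬ W.HasCM → W.analyticRank = 0 → (∀ n : ℕ, 0 < n → W.HasSurjectiveModNGaloisRep ((2 : ℤ) ^ n)) →
      ∃ (K : Type) (_ : Field K) (_ : NumberField K),
        IsImaginaryQuadratic K ∧ Odd (NumberField.discr K) ∧ NumberField.discr K ≠ -3 ∧
        SatisfiesHeegnerHypothesis (W.conductorNorm ℤ) K ∧
        ¬ IsSquare ((NumberField.discr K : ℚ) * -|W.Δ|) ∧ ¬ IsSquare ((NumberField.discr K : ℚ) * (-(2 * |W.Δ|))) ∧
        ∃ (Wd : WeierstrassCurve ℚ) (_ : Wd.IsElliptic) (_ : Wd.IsGloballyMinimal),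
          (∃ C : WeierstrassCurve.VariableChange ℚ, C • W.quadraticTwist (NumberField.discr K : ℚ) = Wd) ∧
          Wd.analyticRank = 1 ∧ Nat.card (Wd.selmerGroup 2) = 2) :
    ∀ (W : WeierstrassCurve ℚ) [W.IsElliptic] [W.IsGloballyMinimal] [NeZero (W.conductorNorm ℤ)],
      ¬ W.HasCM → W.analyticRank = 0 → (∀ n : ℕ, 0 < n → W.HasSurjectiveModNGaloisRep ((2 : ℤ) ^ n)) →
      ∃ (K : Type) (_ : Field K) (_ : NumberField K),
        IsImaginaryQuadratic K ∧ Odd (NumberField.discr K) ∧ NumberField.discr K ≠ -3 ∧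
        SatisfiesHeegnerHypothesis (W.conductorNorm ℤ) K ∧
        ¬ IsSquare ((NumberField.discr K : ℚ) * -|W.Δ|) ∧ ¬ IsSquare ((NumberField.discr K : ℚ) * (-(2 * |W.Δ|))) ∧
        ∃ (Wd : WeierstrassCurve ℚ) (_ : Wd.IsElliptic) (_ : Wd.IsGloballyMinimal),
          (∃ C : WeierstrassCurve.VariableChange ℚ, C • W.quadraticTwist (NumberField.discr K : ℚ) = Wd) ∧
          Nat.card (Wd.selmerGroup 2) = 2 := by
  intro W _ _ _ hcm hr0 hρ
  obtain ⟨K, iF, iN, hIQ, hodd, h3, hHe, hsq1, hsq2, Wd, iE, iM, hWd, -, hSel⟩ := hA W hcm hr0 hρ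
  exact ⟨K, iF, iN, hIQ, hodd, h3, hHe, hsq1, hsq2, Wd, iE, iM, hWd, hSel⟩

/-! ## §3 The cross-route form: stub A on the «good ordinary or multiplicative at 2» twins ⟸ crux 19220 BY NAME -/

/-- **STUB A ⟸ (SUPPLY′) ∧ `RankOneTwoConverse` (crux stmt-BirchSwinnertonDyer-19220 of route `TwoAdicConverse`, BY NAME),
modulo Modularity and `2`-parity.** Same as `stub_minimalTwinSupplyAtTwo_of_twoConverse`, with the `2`-converse taken to be
the tree's typed crux `Summit.BirchSwinnertonDyer.BirchSwinnertonDyer.Theses.TwoAdicConverse.RankOneTwoConverse` («non-CM,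
good ordinary or multiplicative at `2`, `corank_{ℤ₂} Sel_{2^∞} = 1 ⟹ r_an = 1`»), and (SUPPLY′) = (SUPPLY) delivering a twin in
that reduction class (`Rank1Residual.GoodOrd Wd 2 ∨ Rank1Residual.Mult Wd 2`; for `d_K ≡ 1 (mod 8)` — forced when `2 ∣ N_E` —
`E^{(d_K)} ≅ E` over `ℚ₂`, so this is the habitat's own reduction type at `2`). So on the good-ordinary-or-multiplicative
part of the habitat, stub A of crux 22136 is downstream of crux 19220. BSD is not proved by any of this.
[cite: DokchitserDokchitserAnnals2010, Thm. 1.4] [cite: Darmon2004, §3.6 Thm. 3.17] [cite: SilvermanAEC2009, Thm. X.4.2] -/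
theorem stub_minimalTwinSupplyAtTwo_of_rankOneTwoConverse (hmod : exists_isNewformOf)
    (hpar : ∀ V : WeierstrassCurve ℚ, p_parity V 2)
    (hconv : Summit.BirchSwinnertonDyer.BirchSwinnertonDyer.Theses.TwoAdicConverse.RankOneTwoConverse)
    (hsupply : ∀ (W : WeierstrassCurve ℚ) [W.IsElliptic] [W.IsGloballyMinimal] [NeZero (W.conductorNorm ℤ)],
      ¬ W.HasCM → W.analyticRank = 0 → (∀ n : ℕ, 0 < n → W.HasSurjectiveModNGaloisRep ((2 : ℤ) ^ n)) →
      ∃ (K : Type) (_ : Field K) (_ : NumberField K),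
        IsImaginaryQuadratic K ∧ Odd (NumberField.discr K) ∧ NumberField.discr K ≠ -3 ∧
        SatisfiesHeegnerHypothesis (W.conductorNorm ℤ) K ∧
        ¬ IsSquare ((NumberField.discr K : ℚ) * -|W.Δ|) ∧ ¬ IsSquare ((NumberField.discr K : ℚ) * (-(2 * |W.Δ|))) ∧
        ∃ (Wd : WeierstrassCurve ℚ) (_ : Wd.IsElliptic) (_ : Wd.IsGloballyMinimal),
          (∃ C : WeierstrassCurve.VariableChange ℚ, C • W.quadraticTwist (NumberField.discr K : ℚ) = Wd) ∧
          Nat.card (Wd.selmerGroup 2) = 2 ∧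
          (haveI : Fact (Nat.Prime 2) := ⟨Nat.prime_two⟩
           Rank1Residual.GoodOrd Wd 2 ∨ Rank1Residual.Mult Wd 2)) :
    ∀ (W : WeierstrassCurve ℚ) [W.IsElliptic] [W.IsGloballyMinimal] [NeZero (W.conductorNorm ℤ)],
      ¬ W.HasCM → W.analyticRank = 0 → (∀ n : ℕ, 0 < n → W.HasSurjectiveModNGaloisRep ((2 : ℤ) ^ n)) →
      ∃ (K : Type) (_ : Field K) (_ : NumberField K),
        IsImaginaryQuadratic K ∧ Odd (NumberField.discr K) ∧ NumberField.discr K ≠ -3 ∧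
        SatisfiesHeegnerHypothesis (W.conductorNorm ℤ) K ∧
        ¬ IsSquare ((NumberField.discr K : ℚ) * -|W.Δ|) ∧ ¬ IsSquare ((NumberField.discr K : ℚ) * (-(2 * |W.Δ|))) ∧
        ∃ (Wd : WeierstrassCurve ℚ) (_ : Wd.IsElliptic) (_ : Wd.IsGloballyMinimal),
          (∃ C : WeierstrassCurve.VariableChange ℚ, C • W.quadraticTwist (NumberField.discr K : ℚ) = Wd) ∧
          Wd.analyticRank = 1 ∧ Nat.card (Wd.selmerGroup 2) = 2 := by
  haveI : Fact (Nat.Prime 2) := ⟨Nat.prime_two⟩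
  intro W _ _ _ hcm hr0 hρ
  obtain ⟨K, iF, iN, hIQ, hodd, h3, hHe, hsq1, hsq2, Wd, iE, iM, hWd, hSel, hred⟩ := hsupply W hcm hr0 hρ
  refine ⟨K, iF, iN, hIQ, hodd, h3, hHe, hsq1, hsq2, Wd, iE, iM, hWd, ?_, hSel⟩
  have hd : (NumberField.discr K : ℚ) ≠ 0 := by exact_mod_cast NumberField.discr_ne_zero K
  have hcmd : ¬ Wd.HasCM := twin_not_hasCM W hcm hd Wd hWd
  have htors := natCard_twoTorsion_twin_eq_one W (hρ 1 one_pos) hd Wd hWd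
  have hw := rootNumber_twin_eq_neg_one hmod W hr0 K hIQ hHe Wd hWd
  have hco := selmerCorank_two_eq_one_of_card_selmerGroup_two Wd htors hSel
    (odd_selmerCorank_two_of_p_parity Wd (hpar Wd) hw)
  exact hconv Wd hcmd hred hco

end Summit.BirchSwinnertonDyer.BirchSwinnertonDyer.Theorems.GenusKoly

end
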